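import Mathlib.Analysis.InnerProductSpace.Basic
import Mathlib.Algebra.BigOperators.Ring.Finset
import Mathlib.Data.Finset.SymmDiff

/-!
# No centred tight-frame 27-set with inner products `1/10` and `-1/2` (the ghost behind the cell `(10, 1/10)`)

Framing: lottery ticket; floor = certified bounds/negative ranges. Venture `PackingBounds` (cell
`pub-packcert`, recognition seat, T5.md §5/§8).

The Bachoc–Vallentin three-point bound for `A(10, arccos 1/10)` equals `27` exactly, and its
optimiser is a "ghost": complementary slackness (`ThreePointTight.tight_slack_eq_zero`) forces every
hypothetical 27-point code to have all inner products of distinct points in `{1/10, -1/2}`, to be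
centred (`Σ x = 0`, from `a₁ > 0`) and to be a tight frame (`Σ_x ⟨x,v⟩² = (27/10)‖v‖²`, from `a₂ > 0`).
This file proves that NO finite set of unit vectors in any real inner product space has these four
properties (`no_ghost_config_27`). The proof is a parity count: centredness gives every point exactly
`20` neighbours (inner product `1/10`); for two neighbours `y, z` the frame identity at `v = y - z` reads
`81/50 + (9/25)·q = 243/50`, i.e. `q = 9`, where `q` counts the points that are a neighbour of exactly one of
`y, z`; but `q = (20 - 1 - p) + (20 - 1 - p)` is even. (Equivalently: the putative strongly regular graph
`srg(27, 20, 29/2, 15)` has a half-integral `λ`.)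

What is NOT here: the certificate (bound exactly 27) and the derivation of the four properties from it.
-/

open Finset
open scoped RealInnerProductSpace BigOperators

namespace Summit.Ventures.PackingBounds.SphericalCodes

variable {E : Type*} [NormedAddCommGroup E] [InnerProductSpace ℝ E] [DecidableEq E]

/-- In a finite set of unit vectors whose distinct members have inner products `1/10` or `-1/2` and
which is centred in the sense `Σ_{x∈C} ⟨x, y⟩ = 0` for a member `y`, the point `y` has exactly `20`
neighbours at inner product `1/10` — provided `|C| = 27`. -/
theorem ghost27_valency (C : Finset E) (hcard : C.card = 27)
    (hval : ∀ x ∈ C, ∀ y ∈ C, x ≠ y → inner ℝ x y = (1 / 10 : ℝ) ∨ inner ℝ x y = (-1 / 2 : ℝ))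
    (hC : ∀ x ∈ C, ‖x‖ = 1) (y : E) (hy : y ∈ C) (hcent : ∑ x ∈ C, inner ℝ x y = 0) :
    ((C.erase y).filter (fun x => inner ℝ x y = (1 / 10 : ℝ))).card = 20 := by
  classical
  set A := (C.erase y).filter (fun x => inner ℝ x y = (1 / 10 : ℝ)) with hA
  set B := (C.erase y).filter (fun x => ¬ inner ℝ x y = (1 / 10 : ℝ)) with hB
  have hself : inner ℝ y y = (1 : ℝ) := by
    rw [real_inner_self_eq_norm_sq, hC y hy]; norm_num
  have hsplit : ∑ x ∈ C, inner ℝ x y = 1 + ∑ x ∈ C.erase y, inner ℝ x y := by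
    rw [← Finset.add_sum_erase C _ hy, hself]
  have hAB : ∑ x ∈ C.erase y, inner ℝ x y
      = ∑ x ∈ A, inner ℝ x y + ∑ x ∈ B, inner ℝ x y := by
    rw [hA, hB, ← Finset.sum_filter_add_sum_filter_not (C.erase y) (fun x => inner ℝ x y = (1 / 10 : ℝ))]
  have hAsum : ∑ x ∈ A, inner ℝ x y = (A.card : ℝ) * (1 / 10) := by
    rw [Finset.sum_congr rfl (fun x hx => (Finset.mem_filter.1 hx).2), Finset.sum_const, nsmul_eq_mul]
  have hBval : ∀ x ∈ B, inner ℝ x y = (-1 / 2 : ℝ) := by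
    intro x hx
    obtain ⟨hxE, hne⟩ := Finset.mem_filter.1 hx
    have hxC : x ∈ C := Finset.mem_of_mem_erase hxE
    have hxy : x ≠ y := Finset.ne_of_mem_erase hxE
    rcases hval x hxC y hy hxy with h | h
    · exact absurd h hne
    · exact h
  have hBsum : ∑ x ∈ B, inner ℝ x y = (B.card : ℝ) * (-1 / 2) := by
    rw [Finset.sum_congr rfl hBval, Finset.sum_const, nsmul_eq_mul]
  have hcardE : (C.erase y).card = 26 := by
    rw [Finset.card_erase_of_mem hy, hcard]
  have hcardAB : A.card + B.card = 26 := by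
    rw [hA, hB, Finset.card_filter_add_card_filter_not, hcardE]
  have hABr : (A.card : ℝ) + (B.card : ℝ) = 26 := by exact_mod_cast hcardAB
  rw [hsplit, hAB, hAsum, hBsum] at hcent
  have hAr : (A.card : ℝ) = 20 := by linarith
  exact_mod_cast hAr

/-- **No ghost `srg(27, 20, 29/2, 15)` configuration.** There is no finite set `C` of `27` unit vectors
in a real inner product space such that (i) distinct members have inner product `1/10` or `-1/2`,
(ii) `Σ_{x∈C} ⟨x, y⟩ = 0` for every `y ∈ C` (centred), and (iii) `Σ_{x∈C} ⟨x, v⟩² = (27/10)‖v‖²` for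
every `v` (tight frame / spherical 2-design normalisation in dimension 10). Used with the exact
degree-6 three-point certificate of value `27` at `(n, s) = (10, 1/10)` and
`ThreePointTight.tight_slack_eq_zero` to conclude `A(10, arccos 1/10) ≤ 26` (T5.md §5). -/
theorem no_ghost_config_27 (C : Finset E) (hcard : C.card = 27) (hC : ∀ x ∈ C, ‖x‖ = 1)
    (hval : ∀ x ∈ C, ∀ y ∈ C, x ≠ y → inner ℝ x y = (1 / 10 : ℝ) ∨ inner ℝ x y = (-1 / 2 : ℝ))
    (hcent : ∀ y ∈ C, ∑ x ∈ C, inner ℝ x y = 0)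
    (hframe : ∀ v : E, ∑ x ∈ C, (inner ℝ x v) ^ 2 = (27 / 10 : ℝ) * ‖v‖ ^ 2) : False := by
  classical
  -- pick a point y and a neighbour z
  have hne : C.Nonempty := by rw [← Finset.card_pos, hcard]; norm_num
  obtain ⟨y, hy⟩ := hne
  set Ny := (C.erase y).filter (fun x => inner ℝ x y = (1 / 10 : ℝ)) with hNy
  have hNy20 : Ny.card = 20 := ghost27_valency C hcard hval hC y hy (hcent y hy)
  have hNyne : Ny.Nonempty := by rw [← Finset.card_pos, hNy20]; norm_num
  obtain ⟨z, hz⟩ := hNyne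
  obtain ⟨hzE, hzy⟩ := Finset.mem_filter.1 hz
  have hzC : z ∈ C := Finset.mem_of_mem_erase hzE
  have hzney : z ≠ y := Finset.ne_of_mem_erase hzE
  have hyz : inner ℝ y z = (1 / 10 : ℝ) := by rw [real_inner_comm]; exact hzy
  set Nz := (C.erase z).filter (fun x => inner ℝ x z = (1 / 10 : ℝ)) with hNz
  have hNz20 : Nz.card = 20 := ghost27_valency C hcard hval hC z hzC (hcent z hzC)
  have hselfy : inner ℝ y y = (1 : ℝ) := by rw [real_inner_self_eq_norm_sq, hC y hy]; norm_num
  have hselfz : inner ℝ z z = (1 : ℝ) := by rw [real_inner_self_eq_norm_sq, hC z hzC]; norm_num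
  -- the rest R = C \ {y, z}
  set R := (C.erase y).erase z with hR
  have hzR' : z ∈ C.erase y := hzE
  have hRcard : R.card = 25 := by
    rw [hR, Finset.card_erase_of_mem hzR', Finset.card_erase_of_mem hy, hcard]
  -- neighbour sets inside R
  set Ay := R.filter (fun x => inner ℝ x y = (1 / 10 : ℝ)) with hAy
  set Az := R.filter (fun x => inner ℝ x z = (1 / 10 : ℝ)) with hAz
  -- |Ay| = 19 : Ny = insert z Ay (z is a neighbour of y, and Ny ⊆ C.erase y)
  have hAy19 : Ay.card = 19 := by
    have hNy_eq : Ny = insert z Ay := by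
      ext x
      simp only [hNy, hAy, hR, Finset.mem_filter, Finset.mem_insert, Finset.mem_erase]
      constructor
      · rintro ⟨⟨hxy, hxC⟩, hx⟩
        by_cases hxz : x = z
        · exact Or.inl hxz
        · exact Or.inr ⟨⟨hxz, hxy, hxC⟩, hx⟩
      · rintro (rfl | ⟨⟨hxz, hxy, hxC⟩, hx⟩)
        · exact ⟨⟨hzney, hzC⟩, hzy⟩
        · exact ⟨⟨hxy, hxC⟩, hx⟩
    have hzAy : z ∉ Ay := by
      simp [hAy, hR]
    have := Finset.card_insert_of_notMem hzAy
    rw [← hNy_eq, hNy20] at this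
    omega
  -- |Az| = 19 likewise
  have hAz19 : Az.card = 19 := by
    have hNz_eq : Nz = insert y Az := by
      ext x
      simp only [hNz, hAz, hR, Finset.mem_filter, Finset.mem_insert, Finset.mem_erase]
      constructor
      · rintro ⟨⟨hxz, hxC⟩, hx⟩
        by_cases hxy : x = y
        · exact Or.inl hxy
        · exact Or.inr ⟨⟨hxz, hxy, hxC⟩, hx⟩
      · rintro (rfl | ⟨⟨hxz, hxy, hxC⟩, hx⟩)
        · exact ⟨⟨hzney.symm, hy⟩, hyz⟩
        · exact ⟨⟨hxz, hxC⟩, hx⟩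
    have hyAz : y ∉ Az := by
      simp [hAz, hR]
    have := Finset.card_insert_of_notMem hyAz
    rw [← hNz_eq, hNz20] at this
    omega
  -- on R, (⟨x,y⟩ - ⟨x,z⟩)² is 9/25 on the symmetric difference Ay ∆ Az and 0 elsewhere
  have hRval : ∀ x ∈ R, (inner ℝ x y - inner ℝ x z) ^ 2
      = if x ∈ symmDiff Ay Az then (9 / 25 : ℝ) else 0 := by
    intro x hx
    have hxEy : x ∈ C.erase y := Finset.mem_of_mem_erase hx
    have hxC : x ∈ C := Finset.mem_of_mem_erase hxEy
    have hxz : x ≠ z := Finset.ne_of_mem_erase hx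
    have hxy : x ≠ y := Finset.ne_of_mem_erase hxEy
    have hmemAy : x ∈ Ay ↔ inner ℝ x y = (1 / 10 : ℝ) := by simp [hAy, hx]
    have hmemAz : x ∈ Az ↔ inner ℝ x z = (1 / 10 : ℝ) := by simp [hAz, hx]
    rcases hval x hxC y hy hxy with h1 | h1 <;> rcases hval x hxC z hzC hxz with h2 | h2
    · have : x ∉ symmDiff Ay Az := by
        intro h
        rcases Finset.mem_symmDiff.1 h with ⟨_, hb⟩ | ⟨_, hb⟩
        · exact hb (hmemAz.2 h2)
        · exact hb (hmemAy.2 h1)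
      rw [if_neg this, h1, h2]; norm_num
    · have : x ∈ symmDiff Ay Az := by
        rw [Finset.mem_symmDiff]; left
        exact ⟨hmemAy.2 h1, fun h => by rw [hmemAz] at h; rw [h] at h2; norm_num at h2⟩
      rw [if_pos this, h1, h2]; norm_num
    · have : x ∈ symmDiff Ay Az := by
        rw [Finset.mem_symmDiff]; right
        exact ⟨hmemAz.2 h2, fun h => by rw [hmemAy] at h; rw [h] at h1; norm_num at h1⟩
      rw [if_pos this, h1, h2]; norm_num
    · have : x ∉ symmDiff Ay Az := by
        intro h
        rcases Finset.mem_symmDiff.1 h with ⟨ha, _⟩ | ⟨ha, _⟩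
        · rw [hmemAy] at ha; rw [ha] at h1; norm_num at h1
        · rw [hmemAz] at ha; rw [ha] at h2; norm_num at h2
      rw [if_neg this, h1, h2]; norm_num
  -- the frame identity at v = y - z
  have hF := hframe (y - z)
  have hnorm : ‖y - z‖ ^ 2 = (9 / 5 : ℝ) := by
    rw [← real_inner_self_eq_norm_sq]
    simp only [inner_sub_left, inner_sub_right, hselfy, hselfz, hyz, hzy]
    norm_num
  have hsplit : ∑ x ∈ C, (inner ℝ x (y - z)) ^ 2
      = (81 / 100 : ℝ) + (81 / 100 : ℝ) + ∑ x ∈ R, (inner ℝ x y - inner ℝ x z) ^ 2 := by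
    rw [← Finset.add_sum_erase C _ hy, ← Finset.add_sum_erase (C.erase y) _ hzR']
    have e1 : (inner ℝ y (y - z)) ^ 2 = (81 / 100 : ℝ) := by
      rw [inner_sub_right, hselfy, hyz]; norm_num
    have e2 : (inner ℝ z (y - z)) ^ 2 = (81 / 100 : ℝ) := by
      rw [inner_sub_right, hselfz, hzy]; norm_num
    rw [e1, e2, ← add_assoc]
    congr 1
    refine Finset.sum_congr rfl fun x _ => ?_
    rw [inner_sub_right]
  have hRsum : ∑ x ∈ R, (inner ℝ x y - inner ℝ x z) ^ 2
      = (9 / 25 : ℝ) * ((symmDiff Ay Az).card : ℝ) := by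
    have hsub : symmDiff Ay Az ⊆ R := by
      intro x hx
      rcases Finset.mem_symmDiff.1 hx with ⟨ha, _⟩ | ⟨ha, _⟩
      · exact (Finset.mem_filter.1 ha).1
      · exact (Finset.mem_filter.1 ha).1
    rw [Finset.sum_congr rfl hRval, Finset.sum_ite_mem, Finset.inter_eq_right.2 hsub,
      Finset.sum_const, nsmul_eq_mul, mul_comm]
  -- so |Ay ∆ Az| = 9
  have hq : ((symmDiff Ay Az).card : ℝ) = 9 := by
    have h := hF
    rw [hsplit, hRsum, hnorm] at h
    linarith
  have hq9 : (symmDiff Ay Az).card = 9 := by exact_mod_cast hq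
  -- parity: |Ay ∆ Az| + 2 |Ay ∩ Az| = |Ay| + |Az| = 38
  have hpar : (symmDiff Ay Az).card + 2 * (Ay ∩ Az).card = Ay.card + Az.card := by
    have h1 : symmDiff Ay Az = (Ay \ Az) ∪ (Az \ Ay) := Finset.symmDiff_def Ay Az
    have hdisj : Disjoint (Ay \ Az) (Az \ Ay) := disjoint_sdiff_sdiff
    have hc : (symmDiff Ay Az).card = (Ay \ Az).card + (Az \ Ay).card := by
      rw [h1, Finset.card_union_of_disjoint hdisj]
    have h2 := Finset.card_sdiff_add_card_inter Ay Az
    have h3 := Finset.card_sdiff_add_card_inter Az Ay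
    rw [Finset.inter_comm Az Ay] at h3
    omega
  rw [hq9, hAy19, hAz19] at hpar
  omega

end Summit.Ventures.PackingBounds.SphericalCodes
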